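import Summits.CriticalPhenomena.PercolationContinuityZ3.Theorems.PercNonProliferationSubpolynomialBlockingStubTiling
import Literature.Probability.Percolation.HalfSpaceBrickSymmetry
import HarnessLib

/-!
# Crux `PercNonProliferation.SubpolynomialBlocking` (stmt-CriticalPhenomena-4446), line `cross-sandwich-flat-seal` — stub `stub_comparisonGrowing`

Helper file for the lead's skeleton of the line `cross-sandwich-flat-seal` of the crux
`Summit.CriticalPhenomena.PercolationContinuityZ3.Theses.PercNonProliferation.SubpolynomialBlocking`.
Proves exactly the registered stub signature `stub_comparisonGrowing`; lands with
`--supports stmt-CriticalPhenomena-4446`.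

Write `seal_i(Icc a b)` for "NO open path inside the coordinate box `Icc a b ⊆ ℤ³` from its face
`{x_i = a_i}` to its face `{x_i = b_i}`" (the complement of `openCrossing`), `q_n = P(seal₀([0,n]³))`
and `seed_k(n) = P(seal₀([0,n] × [0, n + m]²))`, `m = ⌊n/k⌋`. Statement (the "inch" of the line
with a GROWING power, valid at every `p`): `q_n ^ (3 (m+1)²) ≤ seed_k(n)`.

## The argument

* GEOMETRY (`StubComparisonGrowing.exists_cube_crossing`, deterministic, lattice configurations):
  an open crossing walk of `T = [0,n] × [0,n+m]²` from `{x₀ = 0}` to `{x₀ = n}` contains, for some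
  direction `i ∈ {0,1,2}` and some `0 ≤ a, b ≤ m`, a face-to-face crossing in direction `i` of the
  exact cube translate `[0,n] × [a,a+n] × [b,b+n] ⊆ T`. Localise one transverse coordinate at a
  time (`StubComparisonGrowing.localise`, for a height changing by at most one along edges): either
  the whole walk fits in a band of width `n` (keep it), or it visits two levels `> n` apart and then
  contains a traverse of a band `[a, a+n]`, `a` the minimal level
  (`StubComparisonGrowing.exists_traverse_of_mem_support`, the band-traverse extraction of
  `walk_band_trichotomy` in the barrier file `TransverseCrossingsNeedNotMeetNarrow`).
* Hence `⋂_{i,a,b} seal_i(cube_{a,b}) ⊆ seal₀(T)` on lattice configurations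
  (`DCT16.real_mono_of_forall_subset_edgeSet`); the `3 (m+1)²` events are decreasing, measurable
  (`StubTiling.isLowerSet_seal`, `StubTiling.measurableSet_seal`) and all of probability `q_n` by
  translation and coordinate-permutation invariance (`StubTiling.real_seal_shift`,
  `StubTiling.real_seal_perm`; `StubComparisonGrowing.real_seal_cube`), so Harris–FKG for finitely
  many decreasing events (`prob_pow_le_biInter_of_isLowerSet`, Grimmett 1999 Thm. 2.4) gives
  `q_n ^ (3 (m+1)²) ≤ P(⋂) ≤ seed_k(n)`.

No new definitions; all sets are written exactly as in the registered signature.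
-/

noncomputable section

namespace Summit.CriticalPhenomena.PercolationContinuityZ3.Theorems.SubpolynomialBlocking

open MeasureTheory Filter Topology
open Literature.Probability.Percolation Literature.Probability.LatticeModels
open Literature.Barriers.CriticalPhenomena

namespace StubComparisonGrowing

open SimpleGraph

/-! ### Walks and heights: traverses between visited levels, localisation in a band -/

section Height

variable {V : Type*} {G : SimpleGraph V} (h : V → ℤ)

/-- **Traverse between two visited levels.** For a height changing by at most one along edges and
levels `M₁ ≤ M₂`: a walk visiting a vertex of height `≤ M₁` and a vertex of height `≥ M₂` contains a
sub-walk (vertices and edges among its own) from height `M₁` to height `M₂` staying inside the band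
`[M₁, M₂]` (the third case of `walk_band_trichotomy`: split the walk at the high vertex and apply
`exists_traverse` to the piece containing the low vertex, reversed if it is the tail). -/
theorem exists_traverse_of_mem_support [DecidableEq V]
    (hh : ∀ ⦃u v : V⦄, G.Adj u v → h v ≤ h u + 1) {a b : V} (P : G.Walk a b) {M₁ M₂ : ℤ}
    (hM : M₁ ≤ M₂) (hlow : ∃ v ∈ P.support, h v ≤ M₁) (hhigh : ∃ u ∈ P.support, M₂ ≤ h u) :
    ∃ (c e : V) (W : G.Walk c e), h c = M₁ ∧ h e = M₂ ∧
      (∀ z ∈ W.support, z ∈ P.support ∧ M₁ ≤ h z ∧ h z ≤ M₂) ∧ (∀ x ∈ W.edges, x ∈ P.edges) := by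
  obtain ⟨v, hv, hvM⟩ := hlow
  obtain ⟨u, hu, huM⟩ := hhigh
  have hv' : v ∈ (P.takeUntil u hu).support ∨ v ∈ (P.dropUntil u hu).support := by
    rw [← Walk.mem_support_append_iff, Walk.take_spec]
    exact hv
  rcases hv' with hv' | hv'
  · obtain ⟨c, e, W, hc, he, hW, hWe⟩ :=
      exists_traverse h hh (P.takeUntil u hu) hM ⟨v, hv', hvM⟩ huM
    exact ⟨c, e, W, hc, he,
      fun z hz => ⟨P.support_takeUntil_subset_support hu (hW z hz).1, (hW z hz).2⟩,
      fun x hx => P.edges_takeUntil_subset_edges hu (hWe x hx)⟩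
  · obtain ⟨c, e, W, hc, he, hW, hWe⟩ :=
      exists_traverse h hh (P.dropUntil u hu).reverse hM
        ⟨v, by rw [Walk.support_reverse, List.mem_reverse]; exact hv', hvM⟩ huM
    refine ⟨c, e, W, hc, he, fun z hz => ⟨?_, (hW z hz).2⟩, fun x hx => ?_⟩
    · have hz' := (hW z hz).1
      rw [Walk.support_reverse, List.mem_reverse] at hz'
      exact P.support_dropUntil_subset_support hu hz'
    · have hx' := hWe x hx
      rw [Walk.edges_reverse, List.mem_reverse] at hx'
      exact P.edges_dropUntil_subset_edges hu hx'

/-- **Localisation in a band of width `n`.** For a height changing by at most one along edges and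
a walk all of whose heights lie in `[0, n + m]` (`n, m ≥ 0`), there is an offset `0 ≤ a ≤ m` such
that either every vertex of the walk has height in `[a, a + n]`, or the walk contains a sub-walk
(vertices and edges among its own) from height `a` to height `a + n` staying inside `[a, a + n]`.
(If the maximal and minimal heights differ by `≤ n` take `a = min (min height) m`; otherwise
`a =` the minimal height and extract a traverse.) -/
theorem localise [DecidableEq V] (hh : ∀ ⦃u v : V⦄, G.Adj u v → h v ≤ h u + 1) {x y : V}
    (P : G.Walk x y) {n m : ℤ} (hn : 0 ≤ n) (hm : 0 ≤ m)
    (hP : ∀ z ∈ P.support, 0 ≤ h z ∧ h z ≤ n + m) :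
    ∃ a : ℤ, 0 ≤ a ∧ a ≤ m ∧ ((∀ z ∈ P.support, a ≤ h z ∧ h z ≤ a + n) ∨
      ∃ (c e : V) (W : G.Walk c e), h c = a ∧ h e = a + n ∧
        (∀ z ∈ W.support, z ∈ P.support ∧ a ≤ h z ∧ h z ≤ a + n) ∧
        (∀ q ∈ W.edges, q ∈ P.edges)) := by
  have hne : P.support.toFinset.Nonempty := ⟨x, List.mem_toFinset.2 P.start_mem_support⟩
  obtain ⟨v, hv, hvmin⟩ := P.support.toFinset.exists_min_image h hne
  obtain ⟨u, hu, humax⟩ := P.support.toFinset.exists_max_image h hne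
  rw [List.mem_toFinset] at hv hu
  have hmin : ∀ z ∈ P.support, h v ≤ h z := fun z hz => hvmin z (List.mem_toFinset.2 hz)
  have hmax : ∀ z ∈ P.support, h z ≤ h u := fun z hz => humax z (List.mem_toFinset.2 hz)
  have hv0 := (hP v hv).1
  have hu1 := (hP u hu).2
  by_cases hfit : h u ≤ h v + n
  · rcases le_total (h v) m with hvm | hvm
    · exact ⟨h v, hv0, hvm, Or.inl fun z hz => ⟨hmin z hz, (hmax z hz).trans hfit⟩⟩
    · exact ⟨m, hm, le_rfl, Or.inl fun z hz =>
        ⟨hvm.trans (hmin z hz), by have := (hP z hz).2; omega⟩⟩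
  · rw [not_le] at hfit
    exact ⟨h v, hv0, by omega, Or.inr (exists_traverse_of_mem_support h hh P (by omega)
      ⟨v, hv, le_rfl⟩ ⟨u, hu, by omega⟩)⟩

end Height

/-! ### Geometry of `ℤ³` boxes -/

/-- Coordinate bounds of a point of the flat box `[0,n] × [0,n+m]²`. -/
theorem bounds_of_mem_Icc {z : Site 3} {n m : ℤ}
    (hz : z ∈ Set.Icc (0 : Site 3) ![n, n + m, n + m]) :
    (0 ≤ z 0 ∧ z 0 ≤ n) ∧ (0 ≤ z 1 ∧ z 1 ≤ n + m) ∧ (0 ≤ z 2 ∧ z 2 ≤ n + m) :=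
  ⟨⟨hz.1 0, hz.2 0⟩, ⟨hz.1 1, hz.2 1⟩, ⟨hz.1 2, hz.2 2⟩⟩

/-- A point with coordinates in `[0,n] × [a,a+n] × [b,b+n]` lies in the cube
`Icc ![0,a,b] ![n,a+n,b+n]`. -/
theorem mem_cube {n a b : ℤ} {z : Site 3} (h0 : 0 ≤ z 0) (h0' : z 0 ≤ n) (h1 : a ≤ z 1)
    (h1' : z 1 ≤ a + n) (h2 : b ≤ z 2) (h2' : z 2 ≤ b + n) :
    z ∈ Set.Icc (![0, a, b] : Site 3) ![n, a + n, b + n] :=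
  ⟨fun l => by fin_cases l <;> assumption, fun l => by fin_cases l <;> assumption⟩

/-- **A flat-box crossing contains an exact-cube crossing** (deterministic). For a lattice
configuration `ω ⊆ E(ℤ³)` with an open crossing of `T = [0,n] × [0,n+m]²` (`m ≥ 0`) from
`{x₀ = 0}` to `{x₀ = n}` inside `T`, there are a direction `i` and offsets `0 ≤ a, b ≤ m` such that
`ω` has an open crossing of the cube `[0,n] × [a,a+n] × [b,b+n]` from its face `{x_i = min}` to its
face `{x_i = max}` inside the cube. Proof: take the open lattice walk
(`exists_walk_of_mem_openConnIn`); localise coordinate `1` (`localise`: the walk fits in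
`{a ≤ x₁ ≤ a+n}` — still a direction-`0` crossing — or contains a traverse of that band, a
direction-`1` crossing), then coordinate `2` of the resulting walk likewise; conclude with
`mem_openConnIn_of_walk`. -/
theorem exists_cube_crossing {n m : ℤ} (hm : 0 ≤ m) {ω : BondConfig (Site 3)}
    (hω : ω ⊆ (zdGraph 3).edgeSet)
    (h : ω ∈ openCrossing (Set.Icc (0 : Site 3) ![n, n + m, n + m])
      {x | x ∈ Set.Icc (0 : Site 3) ![n, n + m, n + m] ∧ x 0 = 0}
      {y | y ∈ Set.Icc (0 : Site 3) ![n, n + m, n + m] ∧ y 0 = n}) :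
    ∃ (i : Fin 3) (a b : ℤ), 0 ≤ a ∧ a ≤ m ∧ 0 ≤ b ∧ b ≤ m ∧
      ω ∈ openCrossing (Set.Icc (![0, a, b] : Site 3) ![n, a + n, b + n])
        {x | x ∈ Set.Icc (![0, a, b] : Site 3) ![n, a + n, b + n] ∧
          x i = (![0, a, b] : Site 3) i}
        {y | y ∈ Set.Icc (![0, a, b] : Site 3) ![n, a + n, b + n] ∧
          y i = (![n, a + n, b + n] : Site 3) i} := by
  obtain ⟨x, ⟨-, hx0⟩, y, ⟨-, hy0⟩, hxy⟩ := h
  obtain ⟨P, hPS, hPω⟩ := exists_walk_of_mem_openConnIn hω hxy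
  have hT : ∀ z ∈ P.support,
      (0 ≤ z 0 ∧ z 0 ≤ n) ∧ (0 ≤ z 1 ∧ z 1 ≤ n + m) ∧ (0 ≤ z 2 ∧ z 2 ≤ n + m) :=
    fun z hz => bounds_of_mem_Icc (hPS z hz)
  have hn : 0 ≤ n := by have := (hT x P.start_mem_support).1; omega
  obtain ⟨a, ha0, ham, hA | ⟨c, e, W, hc, he, hW, hWe⟩⟩ :=
    localise (fun z : Site 3 => z 1) (apply_le_apply_add_one_of_adj 1) P hn hm
      fun z hz => (hT z hz).2.1
  · -- every vertex of `P` has `a ≤ z 1 ≤ a + n`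
    obtain ⟨b, hb0, hbm, hB | ⟨c, e, W, hc, he, hW, hWe⟩⟩ :=
      localise (fun z : Site 3 => z 2) (apply_le_apply_add_one_of_adj 2) P hn hm
        fun z hz => (hT z hz).2.2
    · -- `P` itself is a direction-`0` crossing of the cube
      have hin : ∀ z ∈ P.support, z ∈ Set.Icc (![0, a, b] : Site 3) ![n, a + n, b + n] :=
        fun z hz => mem_cube (hT z hz).1.1 (hT z hz).1.2 (hA z hz).1 (hA z hz).2 (hB z hz).1
          (hB z hz).2
      exact ⟨0, a, b, ha0, ham, hb0, hbm, x, ⟨hin x P.start_mem_support, hx0⟩, y,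
        ⟨hin y P.end_mem_support, hy0⟩, mem_openConnIn_of_walk P hin hPω⟩
    · -- a traverse `W ⊆ P` of `{b ≤ x₂ ≤ b + n}`: a direction-`2` crossing of the cube
      have hin : ∀ z ∈ W.support, z ∈ Set.Icc (![0, a, b] : Site 3) ![n, a + n, b + n] :=
        fun z hz => mem_cube (hT z (hW z hz).1).1.1 (hT z (hW z hz).1).1.2 (hA z (hW z hz).1).1
          (hA z (hW z hz).1).2 (hW z hz).2.1 (hW z hz).2.2
      exact ⟨2, a, b, ha0, ham, hb0, hbm, c, ⟨hin c W.start_mem_support, hc⟩, e,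
        ⟨hin e W.end_mem_support, he⟩,
        mem_openConnIn_of_walk W hin fun q hq => hPω q (hWe q hq)⟩
  · -- a traverse `W ⊆ P` of `{a ≤ x₁ ≤ a + n}`
    obtain ⟨b, hb0, hbm, hB | ⟨c', e', W', hc', he', hW', hW'e⟩⟩ :=
      localise (fun z : Site 3 => z 2) (apply_le_apply_add_one_of_adj 2) W hn hm
        fun z hz => (hT z (hW z hz).1).2.2
    · -- `W` is a direction-`1` crossing of the cube
      have hin : ∀ z ∈ W.support, z ∈ Set.Icc (![0, a, b] : Site 3) ![n, a + n, b + n] :=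
        fun z hz => mem_cube (hT z (hW z hz).1).1.1 (hT z (hW z hz).1).1.2 (hW z hz).2.1
          (hW z hz).2.2 (hB z hz).1 (hB z hz).2
      exact ⟨1, a, b, ha0, ham, hb0, hbm, c, ⟨hin c W.start_mem_support, hc⟩, e,
        ⟨hin e W.end_mem_support, he⟩,
        mem_openConnIn_of_walk W hin fun q hq => hPω q (hWe q hq)⟩
    · -- a traverse `W' ⊆ W` of `{b ≤ x₂ ≤ b + n}`: a direction-`2` crossing of the cube
      have hin : ∀ z ∈ W'.support, z ∈ Set.Icc (![0, a, b] : Site 3) ![n, a + n, b + n] :=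
        fun z hz => mem_cube (hT z (hW z (hW' z hz).1).1).1.1 (hT z (hW z (hW' z hz).1).1).1.2
          (hW z (hW' z hz).1).2.1 (hW z (hW' z hz).1).2.2 (hW' z hz).2.1 (hW' z hz).2.2
      exact ⟨2, a, b, ha0, ham, hb0, hbm, c', ⟨hin c' W'.start_mem_support, hc'⟩, e',
        ⟨hin e' W'.end_mem_support, he'⟩,
        mem_openConnIn_of_walk W' hin fun q hq => hPω q (hWe q (hW'e q hq))⟩

/-! ### Symmetry: every cube seal has probability `q_n` -/

/-- The cube `[0,n] × [a,a+n] × [b,b+n]` sealed across any direction `i` has the probability of the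
standard cube `[0,n]³` sealed across direction `0` (translation by `(0,a,b)`,
`StubTiling.real_seal_shift`, then the coordinate transposition `(0 i)`, which fixes the cube
`[0,n]³`, `StubTiling.real_seal_perm`; Grimmett 1999 §1.6). -/
theorem real_seal_cube (p : unitInterval) (n : ℤ) (i : Fin 3) (a b : ℤ) :
    (bondPercolation (zdGraph 3) p).real
        (openCrossing (Set.Icc (![0, a, b] : Site 3) ![n, a + n, b + n])
          {x | x ∈ Set.Icc (![0, a, b] : Site 3) ![n, a + n, b + n] ∧
            x i = (![0, a, b] : Site 3) i}
          {y | y ∈ Set.Icc (![0, a, b] : Site 3) ![n, a + n, b + n] ∧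
            y i = (![n, a + n, b + n] : Site 3) i})ᶜ =
      (bondPercolation (zdGraph 3) p).real
        (openCrossing (Set.Icc (0 : Site 3) ![n, n, n])
          {x | x ∈ Set.Icc (0 : Site 3) ![n, n, n] ∧ x 0 = 0}
          {y | y ∈ Set.Icc (0 : Site 3) ![n, n, n] ∧ y 0 = n})ᶜ := by
  have h1 := StubTiling.real_seal_shift p ![0, a, b] 0 ![n, n, n] i
  rw [zero_add, show (![n, n, n] : Site 3) + ![0, a, b] = ![n, a + n, b + n] from
    funext fun l => by fin_cases l <;> simp <;> ring] at h1
  have hc : ∀ j : Fin 3, (![n, n, n] : Site 3) j = n := fun j => by fin_cases j <;> rfl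
  have h2 := StubTiling.real_seal_perm p (Equiv.swap 0 i) 0 ![n, n, n] 0
  rw [Site.signedPerm_zero,
    show Site.signedPerm (Equiv.swap (0 : Fin 3) i) 1 (![n, n, n] : Site 3) = ![n, n, n] from
      funext fun l => by simp only [Site.signedPerm_apply, Pi.one_apply, Units.val_one, one_mul, hc],
    Equiv.swap_apply_left] at h2
  exact h1.trans h2

end StubComparisonGrowing

/-- **Registered stub `stub_comparisonGrowing`** of line `cross-sandwich-flat-seal` (crux
`SubpolynomialBlocking`, stmt-CriticalPhenomena-4446): the inch of the line with a GROWING power,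
valid at every `p`: `q_n ^ (3 (⌊n/k⌋ + 1)²) ≤ seed_k(n)`, where `q_n = P_p(seal₀([0,n]³))` and
`seed_k(n) = P_p(seal₀([0,n] × [0, n + ⌊n/k⌋]²))`. Every open crossing of the flat box contains a
face-to-face crossing, in some direction, of one of the `(⌊n/k⌋+1)²` exact cube translates
`[0,n] × [a,a+n] × [b,b+n]` (`StubComparisonGrowing.exists_cube_crossing`), so the `3 (⌊n/k⌋+1)²`
cube seals — decreasing events of common probability `q_n`
(`StubComparisonGrowing.real_seal_cube`) — together force the seal of the flat box; Harris–FKG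
(`prob_pow_le_biInter_of_isLowerSet`). -/
theorem stub_comparisonGrowing :
    ∀ (p : unitInterval) (k n : ℕ),
      (bondPercolation (zdGraph 3) p).real
          (openCrossing (Set.Icc (0 : Site 3) ![(n : ℤ), (n : ℤ), (n : ℤ)])
            {x | x ∈ Set.Icc (0 : Site 3) ![(n : ℤ), (n : ℤ), (n : ℤ)] ∧ x 0 = 0}
            {y | y ∈ Set.Icc (0 : Site 3) ![(n : ℤ), (n : ℤ), (n : ℤ)] ∧ y 0 = (n : ℤ)})ᶜ ^ (3 * (n / k + 1) ^ 2) ≤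
        (bondPercolation (zdGraph 3) p).real
          (openCrossing (Set.Icc (0 : Site 3) ![(n : ℤ), (n : ℤ) + (n / k : ℕ), (n : ℤ) + (n / k : ℕ)])
            {x | x ∈ Set.Icc (0 : Site 3) ![(n : ℤ), (n : ℤ) + (n / k : ℕ), (n : ℤ) + (n / k : ℕ)] ∧ x 0 = 0}
            {y | y ∈ Set.Icc (0 : Site 3) ![(n : ℤ), (n : ℤ) + (n / k : ℕ), (n : ℤ) + (n / k : ℕ)] ∧
              y 0 = (n : ℤ)})ᶜ := by
  intro p k n
  have h1 := prob_pow_le_biInter_of_isLowerSet (zdGraph 3) p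
    (Finset.univ : Finset (Fin 3 × Fin (n / k + 1) × Fin (n / k + 1)))
    (fun q => (openCrossing
      (Set.Icc (![0, (q.2.1 : ℤ), (q.2.2 : ℤ)] : Site 3) ![(n : ℤ), (q.2.1 : ℤ) + n, (q.2.2 : ℤ) + n])
      {x | x ∈ Set.Icc (![0, (q.2.1 : ℤ), (q.2.2 : ℤ)] : Site 3)
          ![(n : ℤ), (q.2.1 : ℤ) + n, (q.2.2 : ℤ) + n] ∧
        x q.1 = (![0, (q.2.1 : ℤ), (q.2.2 : ℤ)] : Site 3) q.1}
      {y | y ∈ Set.Icc (![0, (q.2.1 : ℤ), (q.2.2 : ℤ)] : Site 3)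
          ![(n : ℤ), (q.2.1 : ℤ) + n, (q.2.2 : ℤ) + n] ∧
        y q.1 = (![(n : ℤ), (q.2.1 : ℤ) + n, (q.2.2 : ℤ) + n] : Site 3) q.1})ᶜ)
    (fun q _ => StubTiling.isLowerSet_seal _ _ _) (fun q _ => StubTiling.measurableSet_seal _ _ _)
    (fun q _ => StubComparisonGrowing.real_seal_cube p n q.1 q.2.1 q.2.2)
  have hcard : (Finset.univ : Finset (Fin 3 × Fin (n / k + 1) × Fin (n / k + 1))).card =
      3 * (n / k + 1) ^ 2 := by
    rw [Finset.card_univ, Fintype.card_prod, Fintype.card_prod, Fintype.card_fin, Fintype.card_fin,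
      pow_two]
  rw [hcard] at h1
  refine h1.trans (DCT16.real_mono_of_forall_subset_edgeSet _ p fun ω hω hI => ?_)
  intro hT
  obtain ⟨i, a, b, ha0, ham, hb0, hbm, hc⟩ :=
    StubComparisonGrowing.exists_cube_crossing (Nat.cast_nonneg (n / k)) hω hT
  obtain ⟨a, rfl⟩ := Int.eq_ofNat_of_zero_le ha0
  obtain ⟨b, rfl⟩ := Int.eq_ofNat_of_zero_le hb0
  have ha' : a < n / k + 1 := by omega
  have hb' : b < n / k + 1 := by omega
  exact Set.mem_iInter₂.1 hI (i, ⟨a, ha'⟩, ⟨b, hb'⟩) (Finset.mem_univ _) hc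

end Summit.CriticalPhenomena.PercolationContinuityZ3.Theorems.SubpolynomialBlocking

end
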